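import Literature.NumberTheory.EllipticCurves.SupersingularInertiaShapeProofs
import Literature.NumberTheory.GaloisRepresentations.SerreWeightLevelTwoEvaluationProofs
import HarnessLib

/-!
# The inertia shape `diag(ψ₂^{a+qb}, ψ₂^{qa+b})` from an additive embedding equivariant for a POWER `ψ₂^m` of the
# level-two fundamental character, and Serre weight `6` at `p = 3` from a `ψ₂⁷`-equivariant embedding (proofs)

`Proofs` file (theorems only: no definition, no named fact, no instance, no `sorry`), topic
`NumberTheory/EllipticCurves`; sequel of `SupersingularInertiaShapeProofs` (the case `m = 1`, shape `(0, 1)`: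
`WeierstrassCurve.IsTorsionGaloisRep.hasLevelTwoInertiaShape_of_additive_equivariant`) and of
`GaloisRepresentations/SerreWeightLevelTwoEvaluationProofs` (`k = 1 + qa + b` for the shape `(a, b)`).

WHAT. Serre's semilinear algebra (Invent. Math. 15 (1972), §1.10–§1.11: "`E_p` est un `𝔽_{p²}`-espace vectoriel de
dimension `1`") for an additive injective `θ : E[p] → k` that is `ψ₂^m`-EQUIVARIANT on the inertia group
(`θ(σ X) = ψ₂(σ)^m θ(X)`): with `r_c = θ(e⁻¹ e_c)` and the matrix `M` of `σ`, `(r₀ r₁) M = ψ₂(σ)^m (r₀ r₁)` and, by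
Frobenius, `(r₀^p r₁^p) M = ψ₂(σ)^{mp} (r₀^p r₁^p)`; the Moore matrix `P = (r₀^p r₁^p; r₀ r₁)` is invertible and
`P M P⁻¹ = diag(ψ₂^{mq}, ψ₂^m)`. So whenever `ψ₂^{mq} = ψ₂^{a+qb}` and `ψ₂^m = ψ₂^{qa+b}` on inertia (exponent
congruences modulo `q² − 1`), `(ρ̄ ⊗_j k)|Γ_{K_v}` has `HasLevelTwoInertiaShape ι ϖ hϖ a b`:

* `WeierstrassCurve.IsTorsionGaloisRep.hasLevelTwoInertiaShape_of_additive_equivariant_exponent`.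

APPLICATION at `p = 3` (the Kodaira-III half of the tame quartic class (t′), where the graded piece of the formal
group of the quartic-twisted good model carrying `E[3] ∖ 0` has character `θ₄^{-1}θ₈ = ψ₂^{-1} = ψ₂⁷`): a
`ψ₂⁷`-equivariant additive injective `θ` has Frobenius-cube `θ³` which is `ψ₂^{21} = ψ₂⁵`-equivariant, and
`ψ₂^{5·3} = ψ₂⁷ = ψ₂^{1+3·2}`, `ψ₂⁵ = ψ₂^{3·1+2}`: shape `(a, b) = (1, 2)`, weight `1 + 3·1 + 2 = 6`:

* `WeierstrassCurve.serreWeight_eq_six_of_additive_equivariant_pow_seven` — at the canonical local datum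
  `F = ℚ_v` (`#k_v = 3`, uniformiser `3`), Serre's weight of `ρ̄ ⊗_j k` is `6`.

This isolates, for TQMP item W23b (`TprimeIrrKodairaThreeSerreWeightSix`), the representation-theoretic half from
the analytic half (the construction of `θ`), exactly as `SupersingularInertiaShapeFrobeniusTwistProofs` does for
W23a (weight `2`, character `ψ₂³`). Nothing about any particular curve is proved here.

References: [SerreInventiones1972] §1.7 Prop. 3, §1.10 Prop. 10, §1.11 Prop. 12; [Serre1987] §2.2 (2.2.4).
-/

noncomputable section

open scoped Classical NumberField

namespace Literature.NumberTheory.EllipticCurves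

open _root_.WeierstrassCurve Literature.NumberTheory.GaloisRepresentations Field
  IsDedekindDomain IsDedekindDomain.HeightOneSpectrum
  Literature.NumberTheory.GaloisRepresentations.IsNonarchimedeanLocalField
  Literature.NumberTheory.GaloisRepresentations.ModPGaloisRep ValuativeRel

set_option maxHeartbeats 400000 in
/-- **From a `ψ₂^m`-equivariant additive embedding to the level-two inertia shape `(a, b)`.** Let `ρ̄` frame
`E[p]`, `j : 𝔽_p → k`, `ϖ` a uniformiser of `K_v` with `#k_v = p`, `ι` a residue embedding, and `θ : E(K̄) → k`
additive and injective on `E[p]` with `θ(σ X) = ψ₂(σ)^m θ(X)` for `σ` in the inertia group of `K_v`. If the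
exponents satisfy `ψ₂(σ)^{m p} = ψ₂(σ)^{a + p b}` and `ψ₂(σ)^m = ψ₂(σ)^{p a + b}` for all `σ` (congruences mod
`p² − 1`), then `(ρ̄ ⊗_j k)|Γ_{K_v}` has `HasLevelTwoInertiaShape ι ϖ hϖ a b`. The case `m = 1`, `(a, b) = (0, 1)` is
`hasLevelTwoInertiaShape_of_additive_equivariant`; the proof is the same semilinear algebra with `ψ₂^m` for `ψ₂`.
[cite: SerreInventiones1972, §1.10 Prop. 10, §1.11 Prop. 12] -/
theorem _root_.WeierstrassCurve.IsTorsionGaloisRep.hasLevelTwoInertiaShape_of_additive_equivariant_exponent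
    {K : Type} [Field K] [NumberField K]
    {W : WeierstrassCurve K} [W.IsElliptic] {p : ℕ} [hp : Fact p.Prime]
    (v : HeightOneSpectrum (𝓞 K)) {ρ : ModPGaloisRep K (ZMod p) 2} (hρ : W.IsTorsionGaloisRep p ρ)
    {k : Type} [Field k] [TopologicalSpace k] (j : ZMod p →+* k) (hj : Continuous j)
    {ϖ : 𝒪[v.adicCompletion K]} (hϖ : Irreducible ϖ)
    (ι : absIntegers 𝒪[v.adicCompletion K] (v.adicCompletion K) ⧸
      absMaximalIdeal (v.adicCompletion K) →+* k)
    (hq : residueFieldCard (v.adicCompletion K) = p)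
    (θ : geomPoints W → k) (m a b : ℕ)
    (hθadd : ∀ X ∈ geomTorsion W p, ∀ Y ∈ geomTorsion W p, θ (X + Y) = θ X + θ Y)
    (hθinj : ∀ X ∈ geomTorsion W p, θ X = 0 → X = 0)
    (hθsmul : ∀ (σ : absInertia (v.adicCompletion K)), ∀ X ∈ geomTorsion W p,
      θ (absGaloisRestrict K (v.adicCompletion K)
          (σ : absoluteGaloisGroup (v.adicCompletion K)) • X) =
        (fundamentalCharacter (v.adicCompletion K) 2 ι ϖ hϖ σ : k) ^ m * θ X)
    (hexp₀ : ∀ σ : absInertia (v.adicCompletion K),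
      (fundamentalCharacter (v.adicCompletion K) 2 ι ϖ hϖ σ : k) ^ (m * p) =
        (fundamentalCharacter (v.adicCompletion K) 2 ι ϖ hϖ σ : k) ^ (a + p * b))
    (hexp₁ : ∀ σ : absInertia (v.adicCompletion K),
      (fundamentalCharacter (v.adicCompletion K) 2 ι ϖ hϖ σ : k) ^ m =
        (fundamentalCharacter (v.adicCompletion K) 2 ι ϖ hϖ σ : k) ^ (p * a + b)) :
    ModPGaloisRep.HasLevelTwoInertiaShape
      (FramedGaloisRep.restrictField (v.adicCompletion K) (FramedRep.baseChange j hj ρ) :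
        ModPGaloisRep (v.adicCompletion K) k 2) ι ϖ hϖ a b := by
  classical
  haveI hchark : CharP k p := charP_of_injective_ringHom j.injective p
  haveI : ExpChar k p := ExpChar.prime hp.out
  have hθ0 : θ 0 = 0 := by
    have h := hθadd 0 (zero_mem _) 0 (zero_mem _)
    rw [add_zero] at h
    linear_combination -h
  -- `ℕ`-linearity
  have hθnsmul : ∀ (n : ℕ), ∀ X ∈ geomTorsion W p, θ (n • X) = (n : k) * θ X := by
    intro n X hXt
    induction n with
    | zero => rw [zero_nsmul, hθ0, Nat.cast_zero, zero_mul]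
    | succ n ih =>
      rw [succ_nsmul, hθadd _ (AddSubgroup.nsmul_mem _ hXt n) _ hXt, ih, Nat.cast_succ]
      ring
  -- the frame `X_c = e⁻¹(e_c)`, `r c = θ(X_c)`
  obtain ⟨e, he⟩ := id hρ
  let r : Fin 2 → k := fun c ↦ θ ((e.symm (Pi.single c 1) : geomTorsion W p) : geomPoints W)
  have hrdef : ∀ c, r c = θ ((e.symm (Pi.single c 1) : geomTorsion W p) : geomPoints W) :=
    fun c ↦ rfl
  have hcast : ∀ a : ZMod p, (((a.val : ℕ) : k)) = j a := fun a ↦ by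
    rw [← map_natCast j, ZMod.natCast_zmod_val]
  -- `θ(e⁻¹ vv) = j(vv 0) r 0 + j(vv 1) r 1`
  have hlin : ∀ vv : Fin 2 → ZMod p,
      θ ((e.symm vv : geomTorsion W p) : geomPoints W) = j (vv 0) * r 0 + j (vv 1) * r 1 := by
    intro vv
    have hvv : vv = (vv 0).val • Pi.single (0 : Fin 2) (1 : ZMod p) +
        (vv 1).val • Pi.single (1 : Fin 2) (1 : ZMod p) := by
      ext i
      fin_cases i
      · show vv 0 = (vv 0).val • (Pi.single (0 : Fin 2) (1 : ZMod p) : Fin 2 → ZMod p) 0 +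
          (vv 1).val • (Pi.single (1 : Fin 2) (1 : ZMod p) : Fin 2 → ZMod p) 0
        rw [Pi.single_eq_same, Pi.single_eq_of_ne (by decide), smul_zero, add_zero, nsmul_eq_mul,
          mul_one, ZMod.natCast_zmod_val]
      · show vv 1 = (vv 0).val • (Pi.single (0 : Fin 2) (1 : ZMod p) : Fin 2 → ZMod p) 1 +
          (vv 1).val • (Pi.single (1 : Fin 2) (1 : ZMod p) : Fin 2 → ZMod p) 1
        rw [Pi.single_eq_same, Pi.single_eq_of_ne (by decide), smul_zero, zero_add, nsmul_eq_mul,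
          mul_one, ZMod.natCast_zmod_val]
    have h1 : ((e.symm vv : geomTorsion W p) : geomPoints W) =
        (vv 0).val • ((e.symm (Pi.single 0 1) : geomTorsion W p) : geomPoints W) +
          (vv 1).val • ((e.symm (Pi.single 1 1) : geomTorsion W p) : geomPoints W) := by
      conv_lhs => rw [hvv]
      rw [e.symm.map_add, map_nsmul e.symm, map_nsmul e.symm, AddSubgroup.coe_add,
        AddSubgroup.coe_nsmul, AddSubgroup.coe_nsmul]
    rw [h1, hθadd _ (AddSubgroup.nsmul_mem _ (e.symm (Pi.single 0 1)).2 _) _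
      (AddSubgroup.nsmul_mem _ (e.symm (Pi.single 1 1)).2 _),
      hθnsmul _ _ (e.symm (Pi.single 0 1)).2, hθnsmul _ _ (e.symm (Pi.single 1 1)).2, hcast, hcast]
  -- `𝔽_p`-independence of `r 0, r 1`
  have hind : ∀ a b : ZMod p, j a * r 0 + j b * r 1 = 0 → a = 0 ∧ b = 0 := by
    intro a b hab
    have h1 : θ ((e.symm ![a, b] : geomTorsion W p) : geomPoints W) = 0 := by
      rw [hlin]; exact hab
    have h2 : ((e.symm ![a, b] : geomTorsion W p) : geomPoints W) = 0 :=
      hθinj _ (e.symm ![a, b]).2 h1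
    have h3 : (e.symm ![a, b] : geomTorsion W p) = 0 := Subtype.ext h2
    have h4 : (![a, b] : Fin 2 → ZMod p) = 0 := by
      have := congrArg e h3
      rwa [AddEquiv.apply_symm_apply, e.map_zero] at this
    exact ⟨by simpa using congrFun h4 0, by simpa using congrFun h4 1⟩
  -- row identity (A): `Σ_i j(M i c) r i = ψ(σ)^m r c`
  have hrowA : ∀ (σ : absInertia (v.adicCompletion K)) (c : Fin 2),
      j (((ρ (absGaloisRestrict K (v.adicCompletion K) σ) : GL (Fin 2) (ZMod p)) :
          Matrix (Fin 2) (Fin 2) (ZMod p)) 0 c) * r 0 +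
        j (((ρ (absGaloisRestrict K (v.adicCompletion K) σ) : GL (Fin 2) (ZMod p)) :
          Matrix (Fin 2) (Fin 2) (ZMod p)) 1 c) * r 1 =
        (fundamentalCharacter (v.adicCompletion K) 2 ι ϖ hϖ σ : k) ^ m * r c := by
    intro σ c
    set g := absGaloisRestrict K (v.adicCompletion K) σ with hg
    set M : Matrix (Fin 2) (Fin 2) (ZMod p) :=
      ((ρ g : GL (Fin 2) (ZMod p)) : Matrix (Fin 2) (Fin 2) (ZMod p)) with hM
    have hcol : M.mulVec (Pi.single c 1) = fun i ↦ M i c := by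
      ext i; rw [Matrix.mulVec_single_one]; rfl
    have hsymm : (e.symm (fun i ↦ M i c) : geomTorsion W p) = g • e.symm (Pi.single c 1) := by
      rw [AddEquiv.symm_apply_eq, he g, AddEquiv.apply_symm_apply, ← hM, hcol]
    have h1 := hlin (fun i ↦ M i c)
    rw [hsymm, AddSubgroup.torsionBy.coe_smul, hθsmul σ _ (e.symm (Pi.single c 1)).2] at h1
    rw [← hrdef] at h1
    exact h1.symm
  -- row identity (B): Frobenius of (A)
  have hfrobj : ∀ n : ZMod p, j n ^ p = j n := fun n ↦ by rw [← map_pow, ZMod.pow_card]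
  have hrowB : ∀ (σ : absInertia (v.adicCompletion K)) (c : Fin 2),
      j (((ρ (absGaloisRestrict K (v.adicCompletion K) σ) : GL (Fin 2) (ZMod p)) :
          Matrix (Fin 2) (Fin 2) (ZMod p)) 0 c) * r 0 ^ p +
        j (((ρ (absGaloisRestrict K (v.adicCompletion K) σ) : GL (Fin 2) (ZMod p)) :
          Matrix (Fin 2) (Fin 2) (ZMod p)) 1 c) * r 1 ^ p =
        (fundamentalCharacter (v.adicCompletion K) 2 ι ϖ hϖ σ : k) ^ (m * p) * r c ^ p := by
    intro σ c
    rw [pow_mul, ← mul_pow, ← hrowA σ c, add_pow_char, mul_pow, mul_pow, hfrobj, hfrobj]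
  -- the change of basis `P = (r₀^p r₁^p; r₀ r₁)`
  set Pm : Matrix (Fin 2) (Fin 2) k := !![r 0 ^ p, r 1 ^ p; r 0, r 1] with hPm
  have hdet : Pm.det ≠ 0 := by
    rw [hPm, Matrix.det_fin_two_of]
    exact pow_mul_sub_ne_zero_of_forall_eq_zero p j hind
  refine ⟨Matrix.GeneralLinearGroup.mkOfDetNeZero Pm hdet, fun σ ↦ ?_⟩
  set ψ : k := (fundamentalCharacter (v.adicCompletion K) 2 ι ϖ hϖ σ : k) with hψ
  set M : Matrix (Fin 2) (Fin 2) (ZMod p) :=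
    ((ρ (absGaloisRestrict K (v.adicCompletion K) σ) : GL (Fin 2) (ZMod p)) :
      Matrix (Fin 2) (Fin 2) (ZMod p)) with hM
  -- the local representation at `σ` is `M.map j`
  have hloc : ((FramedGaloisRep.restrictField (v.adicCompletion K) (FramedRep.baseChange j hj ρ) :
      ModPGaloisRep (v.adicCompletion K) k 2) (σ : absoluteGaloisGroup (v.adicCompletion K)) :
        Matrix (Fin 2) (Fin 2) k) = M.map j := by
    rw [FramedGaloisRep.restrictField_apply, FramedRep.coe_baseChange_apply]
  -- `Pm (M.map j) = diag(ψ^{mp}, ψ^m) Pm = diag(ψ^{a+pb}, ψ^{pa+b}) Pm`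
  have hkey : Pm * M.map j = !![ψ ^ (a + p * b), 0; 0, ψ ^ (p * a + b)] * Pm := by
    rw [← hexp₀ σ, ← hexp₁ σ]
    ext i c
    rw [Matrix.mul_apply, Matrix.mul_apply, Fin.sum_univ_two, Fin.sum_univ_two, Matrix.map_apply,
      Matrix.map_apply]
    have hA' := hrowA σ c
    have hB' := hrowB σ c
    rw [← hM, ← hψ] at hA' hB'
    fin_cases i <;> fin_cases c <;>
      simp only [hPm, Matrix.of_apply, Matrix.cons_val', Matrix.cons_val_zero, Matrix.cons_val_one,
        Matrix.cons_val_fin_one, Matrix.empty_val', Fin.isValue, Fin.zero_eta, Fin.mk_one] at hA' hB' ⊢ <;>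
      first | linear_combination hB' | linear_combination hA'
  -- conclusion
  have hPP : Pm * ((((Matrix.GeneralLinearGroup.mkOfDetNeZero Pm hdet)⁻¹ : GL (Fin 2) k)) :
      Matrix (Fin 2) (Fin 2) k) = 1 :=
    Units.mul_inv (Matrix.GeneralLinearGroup.mkOfDetNeZero Pm hdet)
  rw [Matrix.GeneralLinearGroup.coe_mul, Matrix.GeneralLinearGroup.coe_mul, hloc]
  change Pm * M.map j * _ = _
  rw [hkey, mul_assoc, hPP, mul_one, hψ]
  simp only [Units.val_pow_eq_pow_val, hq]

/-- **Serre weight `6` at `p = 3` from a `ψ₂⁷`-equivariant additive embedding, at the canonical local datum over `ℚ`.**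
For an elliptic `W/ℚ`, a place `v` of `ℚ` with `#k_v = 3` and uniformiser `3` (supplied by the caller), a framing
`ρ̄` of `E[3]`, a discrete coefficient field `k ⊇ 𝔽₃` (`j`), a residue embedding `ι` for `ℚ_v`, and
`θ : E(ℚ̄) → k` additive and injective on `E[3]` with `θ(σ X) = ψ₂(σ)⁷ θ(X)` on the inertia group of `ℚ_v`
(`ψ₂` w.r.t. the uniformiser `3`; `ψ₂⁷ = ψ₂^{-1}`): Serre's weight of `ρ̄ ⊗_j k` at `F = ℚ_v` is `6`. Proof:
`θ³` is additive, injective and `ψ₂^{21} = ψ₂⁵`-equivariant (`ψ₂⁸ = 1`); `ψ₂^{15} = ψ₂⁷ = ψ₂^{1+3·2}` and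
`ψ₂⁵ = ψ₂^{3·1+2}`, so the shape is `(1, 2)` (`hasLevelTwoInertiaShape_of_additive_equivariant_exponent`) and the
weight is `1 + 3·1 + 2 = 6` (`serreWeight_eq_of_hasLevelTwoInertiaShape`).
[cite: Serre1987, §2.2 (2.2.4)] [cite: SerreInventiones1972, §1.11 Prop. 12] -/
theorem _root_.WeierstrassCurve.serreWeight_eq_six_of_additive_equivariant_pow_seven
    (W : WeierstrassCurve ℚ) [W.IsElliptic] (v : HeightOneSpectrum (𝓞 ℚ))
    (hq : residueFieldCard (v.adicCompletion ℚ) = 3) (hirr : Irreducible ((3 : ℕ) : 𝒪[v.adicCompletion ℚ]))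
    {ρ : ModPGaloisRep ℚ (ZMod 3) 2} (hρ : W.IsTorsionGaloisRep 3 ρ)
    (k : Type) [Field k] [TopologicalSpace k] [DiscreteTopology k] (j : ZMod 3 →+* k)
    (ι : absIntegers 𝒪[v.adicCompletion ℚ] (v.adicCompletion ℚ) ⧸
      absMaximalIdeal (v.adicCompletion ℚ) →+* k)
    (θ : geomPoints W → k)
    (hθadd : ∀ X ∈ geomTorsion W 3, ∀ Y ∈ geomTorsion W 3, θ (X + Y) = θ X + θ Y)
    (hθinj : ∀ X ∈ geomTorsion W 3, θ X = 0 → X = 0)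
    (hθsmul : ∀ (σ : absInertia (v.adicCompletion ℚ)), ∀ X ∈ geomTorsion W 3,
      θ (absGaloisRestrict ℚ (v.adicCompletion ℚ)
          (σ : absoluteGaloisGroup (v.adicCompletion ℚ)) • X) =
        (fundamentalCharacter (v.adicCompletion ℚ) 2 ι ((3 : ℕ) : 𝒪[v.adicCompletion ℚ]) hirr σ : k) ^ 7 *
          θ X) :
    serreWeight 3 (FramedRep.baseChange j continuous_of_discreteTopology ρ)
      { F := v.adicCompletion ℚ
        residueFieldCard_eq := hq
        irreducible_natCast := hirr
        rep := FramedGaloisRep.restrictField (v.adicCompletion ℚ)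
          (FramedRep.baseChange j continuous_of_discreteTopology ρ)
        rep_eq_restrictField := rfl } ι = 6 := by
  haveI : Fact (Nat.Prime 3) := ⟨Nat.prime_three⟩
  haveI : CharP k 3 := charP_of_injective_ringHom j.injective 3
  -- `ψ₂⁸ = 1` pointwise
  have hone : ∀ σ : absInertia (v.adicCompletion ℚ),
      ((fundamentalCharacter (v.adicCompletion ℚ) 2 ι ((3 : ℕ) : 𝒪[v.adicCompletion ℚ]) hirr σ : kˣ) : k) ^ 8
        = 1 := by
    intro σ
    have h := InertiaShape.fundamentalCharacter_pow_eq_one (F := v.adicCompletion ℚ) (k := k) (m := 2)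
      two_ne_zero ι ((3 : ℕ) : 𝒪[v.adicCompletion ℚ]) hirr
    have h' := congrArg (fun χ : absInertia (v.adicCompletion ℚ) →* kˣ ↦ ((χ σ : kˣ) : k)) h
    simp only [MonoidHom.pow_apply, Units.val_pow_eq_pow_val, MonoidHom.one_apply, Units.val_one, hq] at h'
    norm_num at h'
    exact h'
  -- the shape `(1, 2)` from `θ³`
  have hshape : ModPGaloisRep.HasLevelTwoInertiaShape
      (FramedGaloisRep.restrictField (v.adicCompletion ℚ)
        (FramedRep.baseChange j continuous_of_discreteTopology ρ) :
        ModPGaloisRep (v.adicCompletion ℚ) k 2) ι ((3 : ℕ) : 𝒪[v.adicCompletion ℚ]) hirr 1 2 := by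
    refine hρ.hasLevelTwoInertiaShape_of_additive_equivariant_exponent v j continuous_of_discreteTopology hirr ι hq
      (fun X ↦ θ X ^ 3) 5 1 2 ?_ ?_ ?_ ?_ ?_
    · intro X hX Y hY
      rw [hθadd X hX Y hY]
      exact add_pow_char (θ X) (θ Y) 3
    · intro X hX h0
      exact hθinj X hX (pow_eq_zero_iff three_ne_zero |>.mp h0)
    · intro σ X hX
      rw [hθsmul σ X hX, mul_pow, ← pow_mul]
      -- `ψ^21 = ψ^5`
      have h21 : ((fundamentalCharacter (v.adicCompletion ℚ) 2 ι ((3 : ℕ) : 𝒪[v.adicCompletion ℚ]) hirr σ : kˣ)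
          : k) ^ (7 * 3) = ((fundamentalCharacter (v.adicCompletion ℚ) 2 ι ((3 : ℕ) : 𝒪[v.adicCompletion ℚ])
            hirr σ : kˣ) : k) ^ 5 := by
        rw [show 7 * 3 = 8 * 2 + 5 by norm_num, pow_add, pow_mul, hone σ, one_pow, one_mul]
      rw [h21]
    · intro σ
      -- `ψ^{15} = ψ^7 = ψ^{1 + 3·2}`
      rw [show 5 * 3 = 8 + (1 + 3 * 2) by norm_num, pow_add, hone σ, one_mul]
    · intro σ
      -- `ψ^5 = ψ^{3·1+2}`
      norm_num
  have h := serreWeight_eq_of_hasLevelTwoInertiaShape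
    ({ F := v.adicCompletion ℚ
       residueFieldCard_eq := hq
       irreducible_natCast := hirr
       rep := FramedGaloisRep.restrictField (v.adicCompletion ℚ)
         (FramedRep.baseChange j continuous_of_discreteTopology ρ)
       rep_eq_restrictField := rfl } : LocalRestrictionAt 3 (FramedRep.baseChange j continuous_of_discreteTopology ρ))
    ι (a := 1) (b := 2) (by norm_num) (by norm_num) hshape
  simpa using h

end Literature.NumberTheory.EllipticCurves

end
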